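import Literature.NumberTheory.EllipticCurves.GreenbergVatsal2000.GreenbergSelmerGroups
import Literature.NumberTheory.EllipticCurves.H1CorestrictionIndexTwo
import Literature.NumberTheory.EllipticCurves.PeriodIndexCorestrictionLocal
import Literature.NumberTheory.GaloisRepresentations.RestrictedRamification
import Literature.NumberTheory.GaloisRepresentations.DecompositionGroupOfCompletion
import Literature.NumberTheory.GaloisRepresentations.IntegralGaloisActionProofs
import Literature.NumberTheory.Automorphic.AdicCompletionLocalField
import HarnessLib

/-!
# `unramifiedOutside H M p S₀` is the kernel of restriction to the ramification subgroup `N_Σ`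
# (cell `bsd-eis`, seat `bsd-line-x1-p1-w4` gen 4; crux 2 `GoodLatticeBDPValue` stmt-BirchSwinnertonDyer-19032, line `halves`,
# V21 road S4 — transport file (B1))

HONEST FRAMING (cell `bsd-eis`, run/shared/lean/pub/bsd-eis/): Galois-cohomology plumbing for a number field `K` (no definition,
no named fact, no `sorry`, no `Theses` import); nothing about any curve is asserted; BSD / IMC2 / KY Thm. 1.4.1 are proved for NO
curve. Helper `--supports stmt-BirchSwinnertonDyer-19032`; closes no registered stub.

## What

The V21 index road (`Cruxes/GoodLatticeBDPValue/Lines/halves-imprimLambda-index-road.md`, identification (I9)) needs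
`U(M) := unramifiedOutside H M p S₀ ⊆ H¹(H, M)` (Greenberg–Vatsal's place-by-place "`H¹(K_Σ/L, M)`", `L = K̄^H`) to BE the
cohomology of the quotient `Gal(K_Σ/L) = H / N_Σ`, `Σ = S₀ ∪ {w ∣ p}`, `N_Σ = ramificationSubgroup K Σ` (the closed normal
subgroup of `Γ_K` generated by the inertia groups above the places outside `Σ`, tree `RestrictedRamification.lean`), so that the
`H²` bookkeeping of `…EisensteinPrimesH2Bookkeeping` (file (A), over the compact group `H / N_Σ`) can be transported. This file
proves the place-by-place half of (I9), in Greenberg–Vatsal's own currency (no quotient group yet): for `H ⊴ Γ_K` closed with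
`N_Σ ≤ H` and `M` a discrete `Γ_K`-module on which `N_Σ` acts trivially (`M` unramified outside `Σ`),

* §1 dictionary: `GreenbergSelmer.inertia v = I_{𝔓₀(v)} ≤ N_Σ` for `v ∉ Σ` (`inertia_le_ramificationSubgroup_of_not_mem`, via the tree's
  `inertia_adicCompletionPrime_eq_map_absInertia` = `IwasawaTwoVariable.greenbergSelmer_inertia_eq`); every
  element of `inertiaOutside K Σ` is `ρ y ρ⁻¹` with `y ∈ GreenbergSelmer.inertia v`, `v ∉ Σ` (transitivity of `Γ_K` on the primes
  above `v`, tree `exists_smul_eq_of_mem_primesAbove_holds`);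
* §2 `mem_unramifiedOutside_of_resOfLe_eq_zero`: `res_{N_Σ} c = 0 ⟹ c ∈ unramifiedOutside H M p S₀`;
* §3 `apply_eq_zero_of_mem_ramificationSubgroup` (a cocycle of `H` vanishing on `inertiaOutside K Σ` vanishes on `N_Σ`: its zero
  set in `N_Σ` is a closed subgroup containing the conjugation-stable generating set) and
  `resOfLe_eq_zero_of_mem_unramifiedOutside`: `c ∈ unramifiedOutside H M p S₀ ⟹ res_{N_Σ} c = 0`;
* §4 `mem_unramifiedOutside_iff_resOfLe_eq_zero` — **`c ∈ unramifiedOutside H M p S₀ ↔ resOfLe M (N_Σ ≤ H) c = 0`**.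

Next file (B2): inflation `H¹(H/N_Σ, M) ≅ ker(res_{N_Σ})` (tree `infOne_injective` / `infOne_exact_resSubgroup`) and
`cd_p(H/N_Σ) ≤ 2` from the typed fact `DiscreteGaloisModule.groupCdLE_two_galoisGroupUnramifiedOutside`.

References: [GreenbergVatsal2000] §2 pp. 16–17, 23 (`H¹(ℚ_Σ/ℚ_∞, A)` place by place); [NeukirchSchmidtWingberg2008] VIII §3
(`G_S = Γ_K / N_S`); [SerreGaloisCohomology1997] I §2.5, §5.1 (conjugation, cocycle criteria); [NeukirchANT1999] I §9 (9.1)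
(transitivity on primes).
-/

set_option autoImplicit false
set_option linter.dupNamespace false -- the summit namespace `…BirchSwinnertonDyer.BirchSwinnertonDyer.Theorems` (Sub = Summit, D-0017) trips it

noncomputable section

open scoped Pointwise

namespace Summit.BirchSwinnertonDyer.BirchSwinnertonDyer.Theorems.UnramifiedInflation

open Function NumberField IsDedekindDomain Field
open Literature.NumberTheory.EllipticCurves Literature.NumberTheory.EllipticCurves.GreenbergSelmer
  Literature.NumberTheory.EllipticCurves.GreenbergVatsal2000 Literature.NumberTheory.GaloisRepresentations

variable {K : Type} [Field K] [NumberField K]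

/-! ## §1 Dictionary: the chosen inertia groups and the ramification subgroup -/

/-- For `v ∉ Σ`, the chosen inertia group `I_v` lies in the ramification subgroup `N_Σ`.
[cite: NeukirchSchmidtWingberg2008, VIII §3] -/
theorem inertia_le_ramificationSubgroup_of_not_mem {S : Set (HeightOneSpectrum (𝓞 K))} {v : HeightOneSpectrum (𝓞 K)}
    (hv : v ∉ S) : GreenbergSelmer.inertia v ≤ ramificationSubgroup K S := by
  have hI : GreenbergSelmer.inertia v = (adicCompletionPrime K v).inertia (absoluteGaloisGroup K) := by
    rw [GreenbergSelmer.inertia, inertia_adicCompletionPrime_eq_map_absInertia]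
  rw [hI]
  exact inertia_le_ramificationSubgroup hv (adicCompletionPrime_mem_primesAbove K v)

/-- Every inertial element outside `Σ` is conjugate INTO a chosen inertia group: for `x ∈ inertiaOutside K Σ` there are `v ∉ Σ`
and `ρ ∈ Γ_K` with `ρ⁻¹ x ρ ∈ GreenbergSelmer.inertia v` (`Γ_K` acts transitively on the primes above `v`, and
`τ I_𝔓 τ⁻¹ = I_{τ𝔓}`). [cite: NeukirchANT1999, Ch. I §9 Prop. (9.1)] -/
theorem exists_conj_mem_inertia_of_mem_inertiaOutside {S : Set (HeightOneSpectrum (𝓞 K))} {x : absoluteGaloisGroup K}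
    (hx : x ∈ inertiaOutside K S) :
    ∃ v ∉ S, ∃ ρ : absoluteGaloisGroup K, ρ⁻¹ * x * ρ ∈ GreenbergSelmer.inertia v := by
  rw [mem_inertiaOutside_iff] at hx
  obtain ⟨v, hv, 𝔓, h𝔓, hx⟩ := hx
  obtain ⟨ρ, hρ⟩ := HeightOneSpectrum.exists_smul_eq_of_mem_primesAbove_holds h𝔓
    (adicCompletionPrime_mem_primesAbove K v)
  refine ⟨v, hv, ρ⁻¹, ?_⟩
  have hI : GreenbergSelmer.inertia v = (adicCompletionPrime K v).inertia (absoluteGaloisGroup K) := by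
    rw [GreenbergSelmer.inertia, inertia_adicCompletionPrime_eq_map_absInertia]
  rw [hI, inv_inv, ← hρ]
  exact conj_mem_inertia_smul hx ρ

/-! ## §2 Restriction to `N_Σ` zero ⟹ unramified outside `Σ` -/

section Module

variable (H : Subgroup (absoluteGaloisGroup K)) [H.Normal]
variable (M : Type) [AddCommGroup M] [DistribMulAction (absoluteGaloisGroup K) M] [TopologicalSpace M] [DiscreteTopology M]
variable (p : ℕ) (S₀ : Set (HeightOneSpectrum (𝓞 K)))

/-- The cocycle criterion for `unramifiedKer` after conjugation: `conj_σ [φ] ∈ unramifiedKer H M v` iff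
`y ↦ σ • φ(σ⁻¹ y σ)` is principal on `H ⊓ I_v`. [cite: SerreGaloisCohomology1997, I §5.1] [cite: GreenbergVatsal2000, §2 p. 17] -/
theorem conjH1_oneCocycleClass_mem_unramifiedKer_iff (v : HeightOneSpectrum (𝓞 K)) (σ : absoluteGaloisGroup K)
    (φ : contOneCocycles (discreteTopRep H M)) :
    conjH1 H M σ (oneCocycleClass _ φ) ∈ GreenbergVatsal2000.unramifiedKer H M v ↔
      ∃ a : M, ∀ y : inertiaIn H v,
        σ • φ.1 (subgroupConj H σ (inertiaInToH H v y)) = ((y : decomp (K := K) v) : absoluteGaloisGroup K) • a - a := by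
  rw [GreenbergVatsal2000.unramifiedKer, AddMonoidHom.mem_ker, conjH1_oneCocycleClass, resH1Hom_oneCocycleClass, oneCocycleClass_eq_zero_iff]
  rfl

variable {H M p S₀}

/-- **`res_{N_Σ} c = 0 ⟹ c ∈ unramifiedOutside H M p S₀`** (`Σ = S₀ ∪ {w ∣ p}`, `N_Σ ≤ H`, `N_Σ` acting trivially on `M`):
a representing cocycle vanishes on the normal subgroup `N_Σ ⊇ σ⁻¹ I_v σ` for every `v ∉ Σ`, `σ ∈ Γ_K`.
[cite: GreenbergVatsal2000, §2 pp. 16–17, 23] [cite: NeukirchSchmidtWingberg2008, VIII §3] -/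
theorem mem_unramifiedOutside_of_resOfLe_eq_zero
    (hNH : ramificationSubgroup K (S₀ ∪ {v | ((p : ℕ) : 𝓞 K) ∈ v.asIdeal}) ≤ H)
    (htriv : ∀ σ ∈ ramificationSubgroup K (S₀ ∪ {v | ((p : ℕ) : 𝓞 K) ∈ v.asIdeal}), ∀ m : M, σ • m = m)
    {c : subgroupH1 H M} (hc : resOfLe M hNH c = 0) : c ∈ unramifiedOutside H M p S₀ := by
  obtain ⟨φ, rfl⟩ := oneCocycleClass_surjective _ c
  -- `φ` vanishes on `N_Σ`
  rw [resOfLe, resH1Hom_oneCocycleClass, oneCocycleClass_eq_zero_iff] at hc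
  obtain ⟨a, ha⟩ := hc
  have hφ : ∀ (n : absoluteGaloisGroup K) (hn : n ∈ ramificationSubgroup K (S₀ ∪ {v | ((p : ℕ) : 𝓞 K) ∈ v.asIdeal})),
      φ.1 ⟨n, hNH hn⟩ = 0 := by
    intro n hn
    have h := ha ⟨n, hn⟩
    rw [pullback_resHomOfEquivariant_apply, AddMonoidHom.id_apply] at h
    have h' : φ.1 ⟨n, hNH hn⟩ = n • a - a := h
    rw [h', htriv n hn a, sub_self]
  rw [mem_unramifiedOutside_iff]
  intro v hvS hvp σ
  have hvS' : v ∉ S₀ ∪ {v | ((p : ℕ) : 𝓞 K) ∈ v.asIdeal} := fun h ↦ h.elim hvS hvp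
  rw [conjH1_oneCocycleClass_mem_unramifiedKer_iff]
  refine ⟨0, fun y ↦ ?_⟩
  have hyI : ((y : decomp (K := K) v) : absoluteGaloisGroup K) ∈ GreenbergSelmer.inertia v := ((mem_inertiaIn_iff H v _).1 y.2).2
  have hyN : ((y : decomp (K := K) v) : absoluteGaloisGroup K) ∈ ramificationSubgroup K (S₀ ∪ {v | ((p : ℕ) : 𝓞 K) ∈ v.asIdeal}) :=
    inertia_le_ramificationSubgroup_of_not_mem hvS' hyI
  have hconj : σ⁻¹ * ((y : decomp (K := K) v) : absoluteGaloisGroup K) * σ ∈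
      ramificationSubgroup K (S₀ ∪ {v | ((p : ℕ) : 𝓞 K) ∈ v.asIdeal}) := by
    have := (ramificationSubgroup_normal K (S₀ ∪ {v | ((p : ℕ) : 𝓞 K) ∈ v.asIdeal})).conj_mem _ hyN σ⁻¹
    rwa [inv_inv] at this
  have hval : subgroupConj H σ (inertiaInToH H v y) = ⟨σ⁻¹ * ((y : decomp (K := K) v) : absoluteGaloisGroup K) * σ, hNH hconj⟩ :=
    Subtype.ext (by rw [subgroupConj_apply_coe]; rfl)
  rw [hval, hφ _ hconj, smul_zero, smul_zero, sub_self]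

/-! ## §3 Unramified outside `Σ` ⟹ restriction to `N_Σ` zero -/

omit [NumberField K] [H.Normal] in
/-- **A cocycle of `H` vanishing on `inertiaOutside K Σ` vanishes on all of `N_Σ`** (`N_Σ ≤ H`, `H` closed): the zero set of the cocycle inside `N_Σ` is a closed subgroup (on `N_Σ` the cocycle is a homomorphism) containing
the conjugation-stable set `inertiaOutside K Σ`, hence its normal closure, hence the topological closure `N_Σ`.
[cite: NeukirchSchmidtWingberg2008, VIII §3] [cite: SerreGaloisCohomology1997, I §5.1] -/
theorem apply_eq_zero_of_mem_ramificationSubgroup {S : Set (HeightOneSpectrum (𝓞 K))}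
    (hH : IsClosed (H : Set (absoluteGaloisGroup K))) (hNH : ramificationSubgroup K S ≤ H)
    (φ : contOneCocycles (discreteTopRep H M))
    (hφ : ∀ (x : absoluteGaloisGroup K) (hx : x ∈ inertiaOutside K S),
      φ.1 ⟨x, hNH (Subgroup.le_topologicalClosure _ (Subgroup.subset_normalClosure hx))⟩ = 0)
    {n : absoluteGaloisGroup K} (hn : n ∈ ramificationSubgroup K S) : φ.1 ⟨n, hNH hn⟩ = 0 := by
  -- the zero set of `φ` inside `N_Σ`, a subgroup of `Γ_K`
  let W : Subgroup (absoluteGaloisGroup K) :=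
    { carrier := {g | ∃ hg : g ∈ ramificationSubgroup K S, φ.1 ⟨g, hNH hg⟩ = 0}
      one_mem' := ⟨one_mem _, by
        have h1 : (⟨1, hNH (one_mem _)⟩ : H) = 1 := rfl
        rw [h1]; exact contOneCocycles.apply_one φ⟩
      mul_mem' := by
        rintro a b ⟨ha, ha0⟩ ⟨hb, hb0⟩
        refine ⟨mul_mem ha hb, ?_⟩
        have hab : (⟨a * b, hNH (mul_mem ha hb)⟩ : H) = ⟨a, hNH ha⟩ * ⟨b, hNH hb⟩ := rfl
        rw [hab, φ.2, ha0, hb0, map_zero, add_zero]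
      inv_mem' := by
        rintro a ⟨ha, ha0⟩
        refine ⟨inv_mem ha, ?_⟩
        have h := φ.2 ⟨a⁻¹, hNH (inv_mem ha)⟩ ⟨a, hNH ha⟩
        have hmul : (⟨a⁻¹, hNH (inv_mem ha)⟩ : H) * ⟨a, hNH ha⟩ = 1 := Subtype.ext (inv_mul_cancel a)
        rw [hmul, contOneCocycles.apply_one, ha0, map_zero, add_zero] at h
        exact h.symm }
  -- `W` is closed
  have hWc : IsClosed (W : Set (absoluteGaloisGroup K)) := by
    have hZ : IsClosed (((↑) : H → absoluteGaloisGroup K) '' {x : H | φ.1 x = 0}) :=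
      hH.isClosedEmbedding_subtypeVal.isClosedMap _ (isClosed_singleton.preimage φ.1.continuous)
    have hW : (W : Set (absoluteGaloisGroup K)) =
        (ramificationSubgroup K S : Set (absoluteGaloisGroup K)) ∩ (((↑) : H → absoluteGaloisGroup K) '' {x : H | φ.1 x = 0}) := by
      ext g
      constructor
      · rintro ⟨hg, hg0⟩
        exact ⟨hg, ⟨g, hNH hg⟩, hg0, rfl⟩
      · rintro ⟨hg, x, hx0, rfl⟩
        exact ⟨hg, hx0⟩
    rw [hW]
    exact (ramificationSubgroup_isClosed K S).inter hZ
  -- `inertiaOutside ⊆ W`, a conjugation-stable set, hence `normalClosure ≤ W`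
  have hXW : inertiaOutside K S ⊆ W := fun x hx ↦
    ⟨Subgroup.le_topologicalClosure _ (Subgroup.subset_normalClosure hx), hφ x hx⟩
  have hconjW : Group.conjugatesOfSet (inertiaOutside K S) ⊆ W := by
    intro y hy
    rw [Group.mem_conjugatesOfSet_iff] at hy
    obtain ⟨x, hx, hxy⟩ := hy
    obtain ⟨c, rfl⟩ := isConj_iff.1 hxy
    exact hXW (conj_mem_inertiaOutside hx c)
  have hNW : Subgroup.normalClosure (inertiaOutside K S) ≤ W := by
    rw [Subgroup.normalClosure]
    exact (Subgroup.closure_le W).2 hconjW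
  have hle : ramificationSubgroup K S ≤ W := Subgroup.topologicalClosure_minimal _ hNW hWc
  obtain ⟨hn', h0⟩ := hle hn
  exact h0

/-- **`c ∈ unramifiedOutside H M p S₀ ⟹ res_{N_Σ} c = 0`** (`H` closed normal, `N_Σ ≤ H`, `N_Σ` acting trivially on `M`): the
unramified conditions at all places above every `v ∉ Σ` say that a representing cocycle kills every conjugate of every chosen
inertia group `I_v`, i.e. all of `inertiaOutside K Σ` (transitivity on primes), hence `N_Σ`.
[cite: GreenbergVatsal2000, §2 pp. 16–17, 23] [cite: NeukirchSchmidtWingberg2008, VIII §3] -/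
theorem resOfLe_eq_zero_of_mem_unramifiedOutside (hH : IsClosed (H : Set (absoluteGaloisGroup K)))
    (hNH : ramificationSubgroup K (S₀ ∪ {v | ((p : ℕ) : 𝓞 K) ∈ v.asIdeal}) ≤ H)
    (htriv : ∀ σ ∈ ramificationSubgroup K (S₀ ∪ {v | ((p : ℕ) : 𝓞 K) ∈ v.asIdeal}), ∀ m : M, σ • m = m)
    {c : subgroupH1 H M} (hc : c ∈ unramifiedOutside H M p S₀) : resOfLe M hNH c = 0 := by
  obtain ⟨φ, rfl⟩ := oneCocycleClass_surjective _ c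
  rw [mem_unramifiedOutside_iff] at hc
  -- `φ` kills `inertiaOutside K Σ`
  have hφX : ∀ (x : absoluteGaloisGroup K) (hx : x ∈ inertiaOutside K (S₀ ∪ {v | ((p : ℕ) : 𝓞 K) ∈ v.asIdeal})),
      φ.1 ⟨x, hNH (Subgroup.le_topologicalClosure _ (Subgroup.subset_normalClosure hx))⟩ = 0 := by
    intro x hx
    obtain ⟨v, hvS', ρ, hy⟩ := exists_conj_mem_inertia_of_mem_inertiaOutside hx
    have hvS : v ∉ S₀ := fun h ↦ hvS' (Or.inl h)
    have hvp : ((p : ℕ) : 𝓞 K) ∉ v.asIdeal := fun h ↦ hvS' (Or.inr h)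
    obtain ⟨a, ha⟩ := (conjH1_oneCocycleClass_mem_unramifiedKer_iff H M v ρ⁻¹ φ).1 (hc v hvS hvp ρ⁻¹)
    set y : absoluteGaloisGroup K := ρ⁻¹ * x * ρ with hydef
    have hyN : y ∈ ramificationSubgroup K (S₀ ∪ {v | ((p : ℕ) : 𝓞 K) ∈ v.asIdeal}) :=
      inertia_le_ramificationSubgroup_of_not_mem hvS' hy
    let y' : inertiaIn H v := ⟨⟨y, inertia_le_decomp v hy⟩, (mem_inertiaIn_iff H v _).2 ⟨hNH hyN, hy⟩⟩
    have h := ha y'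
    have hval : subgroupConj H ρ⁻¹ (inertiaInToH H v y') =
        ⟨x, hNH (Subgroup.le_topologicalClosure _ (Subgroup.subset_normalClosure hx))⟩ :=
      Subtype.ext (by
        rw [subgroupConj_apply_coe, inv_inv]
        change ρ * (ρ⁻¹ * x * ρ) * ρ⁻¹ = x
        group)
    have hrhs : ((y' : decomp (K := K) v) : absoluteGaloisGroup K) • a - a = 0 := by
      change y • a - a = 0
      rw [htriv y hyN a, sub_self]
    rw [hval, hrhs, smul_eq_zero_iff_eq] at h
    exact h
  -- hence `N_Σ`
  rw [resOfLe, resH1Hom_oneCocycleClass, oneCocycleClass_eq_zero_iff]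
  refine ⟨0, fun n ↦ ?_⟩
  rw [pullback_resHomOfEquivariant_apply, AddMonoidHom.id_apply, map_zero, sub_zero]
  exact apply_eq_zero_of_mem_ramificationSubgroup hH hNH φ hφX n.2

/-! ## §4 The identification -/

/-- **`unramifiedOutside H M p S₀ = ker(res : H¹(H, M) → H¹(N_Σ, M))`**, `Σ = S₀ ∪ {w ∣ p}`, for `H ⊴ Γ_K` closed containing the
ramification subgroup `N_Σ` and `M` a discrete `Γ_K`-module on which `N_Σ` acts trivially: Greenberg–Vatsal's place-by-place
`H¹(K_Σ/L, M)` (p. 16 "`H¹(ℚ_Σ/ℚ_∞, A)`", p. 23 "we may take `Σ = Σ₀ ∪ {p, ∞}`") is the image of inflation from `Gal(K_Σ/L)`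
(identification (I9) of the V21 road memo; the inflation half is file (B2)).
[cite: GreenbergVatsal2000, §2 pp. 16–17, 23] [cite: NeukirchSchmidtWingberg2008, VIII §3] -/
theorem mem_unramifiedOutside_iff_resOfLe_eq_zero (hH : IsClosed (H : Set (absoluteGaloisGroup K)))
    (hNH : ramificationSubgroup K (S₀ ∪ {v | ((p : ℕ) : 𝓞 K) ∈ v.asIdeal}) ≤ H)
    (htriv : ∀ σ ∈ ramificationSubgroup K (S₀ ∪ {v | ((p : ℕ) : 𝓞 K) ∈ v.asIdeal}), ∀ m : M, σ • m = m)
    (c : subgroupH1 H M) : c ∈ unramifiedOutside H M p S₀ ↔ resOfLe M hNH c = 0 :=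
  ⟨resOfLe_eq_zero_of_mem_unramifiedOutside hH hNH htriv, mem_unramifiedOutside_of_resOfLe_eq_zero hNH htriv⟩

/-- The same identification as an equality of subgroups of `H¹(H, M)`. [cite: GreenbergVatsal2000, §2 pp. 16–17, 23] -/
theorem unramifiedOutside_eq_ker_resOfLe (hH : IsClosed (H : Set (absoluteGaloisGroup K)))
    (hNH : ramificationSubgroup K (S₀ ∪ {v | ((p : ℕ) : 𝓞 K) ∈ v.asIdeal}) ≤ H)
    (htriv : ∀ σ ∈ ramificationSubgroup K (S₀ ∪ {v | ((p : ℕ) : 𝓞 K) ∈ v.asIdeal}), ∀ m : M, σ • m = m) :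
    unramifiedOutside H M p S₀ = (resOfLe M hNH).ker :=
  AddSubgroup.ext fun c ↦ (mem_unramifiedOutside_iff_resOfLe_eq_zero hH hNH htriv c).trans (AddMonoidHom.mem_ker).symm

end Module

end Summit.BirchSwinnertonDyer.BirchSwinnertonDyer.Theorems.UnramifiedInflation

end
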